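import Summits.AtomisticToContinuum.BoseEinsteinCondensation.Theses.BECRieszReverseHolder
import Literature.MathematicalPhysics.QuantumManyBody.BoseGasThermodynamicLimitRuelle

/-!
# Glue: `RieszShadowFieldMoment` + field-moment domination ⇒ `CoarseGrainedReverseHolder`

Support lemma for the informal item `BoseRieszMembership` (stmt-AtomisticToContinuum-12602) of route
BECRieszReverseHolder: if the coarse-grained RH₂ slice functional of non-negative near-minimisers is
dominated by the `θ = 2` cavity-field exponential moment of the shadow Riesz-2 gas (the typed candidate for
`BoseRieszMembership`, inlined as hypothesis `hM`), then the route crux `RieszShadowFieldMoment` yields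
`CoarseGrainedReverseHolder`.
-/

namespace Summit.AtomisticToContinuum.BoseEinsteinCondensation.Theorems

open MeasureTheory Filter
open scoped ENNReal
open Summit.AtomisticToContinuum.BoseEinsteinCondensation.Theses.BECRieszReverseHolder
open Literature.MathematicalPhysics.QuantumManyBody

/-- **Glue.** `RieszShadowFieldMoment` together with the field-moment domination form of
`BoseRieszMembership` (hypothesis `hM`, a typed candidate for the informal item
stmt-AtomisticToContinuum-12602: the coarse-grained RH₂ slice functional of every non-negative
near-minimiser — verbatim the left side of `CoarseGrainedReverseHolder` — is at most `A·(1 + S)`, `S` the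
supremum over `y` of the `θ = 2` cavity-field exponential moment of the shadow smeared Riesz-2 gas of
`RieszShadowFieldMoment`, in the Bose dictionary `b = 2π^{-3/2}(a/ρ)^{1/2}`,
`η = max((8πρa)^{-1/2}, ρ^{-1/3})`, `a` the scattering length) implies the crux
`CoarseGrainedReverseHolder`, with constant `max A 0 · (1 + max C 1)`. The case `a = 0` (so `b = 0`,
`S ≤ 1`) needs no classical input; for `a > 0` the Kac corner `(n/L³)η³ ≥ (ρ/2)·(8πρa)^{-3/2} ≥ 1`
holds for `n ≥ 1` and `ρ ≤ (4(8πa)³)⁻¹`, the coupling corner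
`b (n/L³)^{2/3} ≤ 2π^{-3/2} a^{1/2} ρ^{1/6} < Γ₀` for `ρ < (Γ₀/(2π^{-3/2}a^{1/2} + 1))⁶`, and `η ≤ L`
eventually; the route's `ρ₀` is the minimum of these thresholds and the one of `hM`. -/
theorem coarseGrainedReverseHolder_of_fieldMomentDomination (hR : RieszShadowFieldMoment)
    (hM : ∀ v : ℝ → ENNReal, BoseGas.IsRepulsiveFiniteRange v →
      ∃ ρ₀ : ℝ, 0 < ρ₀ ∧ ∀ ρ : ℝ, 0 < ρ → ρ < ρ₀ → ∀ ℓ : ℝ, 0 < ℓ → ∃ A : ℝ,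
      ∀ᶠ n : ℕ in Filter.atTop, ∃ δ : ENNReal, 0 < δ ∧
        ∀ Ψ : BoseGas.TrialState (n + 1) (BoseGas.sideLength ρ (n + 1)),
          BoseGas.energy v Ψ ≤ BoseGas.groundStateEnergy v (n + 1) (BoseGas.sideLength ρ (n + 1)) + δ →
          (∀ X, Ψ.ψ X = (‖Ψ.ψ X‖ : ℂ)) →
          let L := BoseGas.sideLength ρ (n + 1)
          let m := ⌊L / ℓ⌋₊
          let a := (BoseGas.scatteringLength v).toReal
          let b := 2 * Real.pi ^ (-(3 / 2 : ℝ)) * (a / ρ) ^ (1 / 2 : ℝ)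
          let η := max ((8 * Real.pi * ρ * a) ^ (-(1 / 2 : ℝ))) (ρ ^ (-(1 / 3 : ℝ)))
          let g : BoseGas.Space → ℝ := fun x =>
            2 * Real.pi ^ (3 / 2 : ℝ) * ∫ t in Set.Ioi (η ^ 2), t ^ (-(1 / 2 : ℝ)) *
              ((∑' mm : Fin 3 → ℤ, Literature.Analysis.UnboundedOperators.heatKernel t
                (x - BoseGas.latticeVec L mm)) - 1 / L ^ 3)
          let H : BoseGas.Config n → ℝ := fun X => ∑ i : Fin n, ∑ j : Fin n with i < j, g (X i - X j)
          (m : ENNReal) ^ 3 * ∫⁻ X : Fin n → EuclideanSpace ℝ (Fin 3),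
              ((∑ k : Fin 3 → Fin m,
                  (∫⁻ y in {y : EuclideanSpace ℝ (Fin 3) |
                      ∀ i, y i ∈ Set.Ico ((k i : ℝ) * (L / m)) (((k i : ℝ) + 1) * (L / m))},
                    (‖Ψ.ψ (Matrix.vecCons y X)‖₊ : ENNReal) ^ 2) ^ 2) /
                (∫⁻ y, (‖Ψ.ψ (Matrix.vecCons y X)‖₊ : ENNReal) ^ 2))
            ≤ ENNReal.ofReal A * (1 +
              ⨆ y : BoseGas.Space,
                (∫⁻ X in BoseGas.cellN n L,
                    ENNReal.ofReal (Real.exp (-(b * H X) - 2 * b * ∑ j : Fin n, g (y - X j)))) /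
                (∫⁻ X in BoseGas.cellN n L, ENNReal.ofReal (Real.exp (-(b * H X)))))) :
    CoarseGrainedReverseHolder := by
  intro v hv
  obtain ⟨ρM, hρM, hMv⟩ := hM v hv
  obtain ⟨Γ₀, hΓ₀, C, hC⟩ := hR
  -- the scattering length as a real number and the coupling prefactor `K = 2π^{-3/2} a^{1/2}`
  set a : ℝ := (BoseGas.scatteringLength v).toReal with ha_def
  have ha0 : 0 ≤ a := ENNReal.toReal_nonneg
  set K : ℝ := 2 * Real.pi ^ (-(3 / 2 : ℝ)) * a ^ (1 / 2 : ℝ) with hK_def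
  have hK0 : 0 ≤ K := by positivity
  -- coupling threshold: below `ρ₁`, `K ρ^{1/6} < Γ₀`
  set ρ₁ : ℝ := (Γ₀ / (K + 1)) ^ (6 : ℕ) with hρ₁_def
  have hq : 0 < Γ₀ / (K + 1) := div_pos hΓ₀ (by linarith)
  have hρ₁ : 0 < ρ₁ := pow_pos hq 6
  have hsmall : ∀ ρ : ℝ, 0 < ρ → ρ < ρ₁ → K * ρ ^ (1 / 6 : ℝ) < Γ₀ := by
    intro ρ hρ hρlt
    have h1 : ρ ^ (1 / 6 : ℝ) < ρ₁ ^ (1 / 6 : ℝ) :=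
      Real.rpow_lt_rpow hρ.le hρlt (by norm_num)
    have h2 : ρ₁ ^ (1 / 6 : ℝ) = Γ₀ / (K + 1) := by
      rw [hρ₁_def, one_div]
      exact Real.pow_rpow_inv_natCast hq.le (by norm_num)
    have h3 : 0 ≤ ρ ^ (1 / 6 : ℝ) := Real.rpow_nonneg hρ.le _
    calc K * ρ ^ (1 / 6 : ℝ) ≤ (K + 1) * ρ ^ (1 / 6 : ℝ) := by nlinarith
      _ < (K + 1) * (Γ₀ / (K + 1)) := by
          rw [← h2]; exact mul_lt_mul_of_pos_left h1 (by linarith)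
      _ = Γ₀ := by field_simp
  -- Kac threshold: below `ρ₂`, `ρ ξ³ ≥ 2` for the healing length `ξ = (8πρa)^{-1/2}` (only used if `a > 0`)
  set ρ₂ : ℝ := (4 * (8 * Real.pi * a) ^ 3 + 1)⁻¹ with hρ₂_def
  have hρ₂ : 0 < ρ₂ := by positivity
  refine ⟨min ρM (min ρ₁ ρ₂), lt_min hρM (lt_min hρ₁ hρ₂), fun ρ hρ hρlt ℓ hℓ => ?_⟩
  have hρM' : ρ < ρM := hρlt.trans_le (min_le_left _ _)
  have hρ₁' : ρ < ρ₁ := (hρlt.trans_le (min_le_right _ _)).trans_le (min_le_left _ _)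
  have hρ₂' : ρ < ρ₂ := (hρlt.trans_le (min_le_right _ _)).trans_le (min_le_right _ _)
  obtain ⟨A, hA⟩ := hMv ρ hρ hρM' ℓ hℓ
  refine ⟨max A 0 * (1 + max C 1), ?_⟩
  -- the smearing length of the dictionary
  set η : ℝ := max ((8 * Real.pi * ρ * a) ^ (-(1 / 2 : ℝ))) (ρ ^ (-(1 / 3 : ℝ))) with hη_def
  have hη0 : 0 < η := lt_max_of_lt_right (Real.rpow_pos_of_pos hρ _)
  have hL_ev : ∀ᶠ n : ℕ in atTop, η ≤ BoseGas.sideLength ρ (n + 1) :=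
    ((BoseGas.tendsto_sideLength_atTop hρ).comp (tendsto_add_atTop_nat 1)).eventually_ge_atTop η
  filter_upwards [hA, hL_ev, eventually_ge_atTop 1] with n hn hLn hn1
  obtain ⟨δ, hδ, hΨ⟩ := hn
  refine ⟨δ, hδ, fun Ψ hE hpos => ?_⟩
  have key := hΨ Ψ hE hpos
  dsimp only at key ⊢
  refine key.trans ?_
  set L : ℝ := BoseGas.sideLength ρ (n + 1) with hL_def
  have hL : 0 < L := lt_of_lt_of_le hη0 hLn
  have hL3 : L ^ 3 = ((n : ℝ) + 1) / ρ := by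
    rw [hL_def, BoseGas.sideLength_pow_three hρ]; push_cast; ring
  set b : ℝ := 2 * Real.pi ^ (-(3 / 2 : ℝ)) * (a / ρ) ^ (1 / 2 : ℝ) with hb_def
  have hb0 : 0 ≤ b := by positivity
  -- it remains to bound the supremum of the shadow's field moment by `max C 1`
  calc _ ≤ ENNReal.ofReal (max A 0) * (1 + ENNReal.ofReal (max C 1)) := by
        gcongr ENNReal.ofReal ?_ * (1 + ?_)
        · exact le_max_left _ _
        refine iSup_le fun y => ?_
        rcases ha0.eq_or_lt with ha_zero | ha_pos
        · -- `a = 0`: no coupling, numerator = denominator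
          have hb_zero : b = 0 := by
            rw [hb_def, ← ha_zero, zero_div, Real.zero_rpow (by norm_num)]; ring
          simp only [hb_zero, zero_mul, mul_zero, neg_zero, sub_zero]
          exact ENNReal.div_self_le_one.trans (by simp)
        · -- `a > 0`: the classical engine in the Kac / weak-coupling corner
          have hb : 0 < b := by rw [hb_def]; positivity
          have hn1' : (1 : ℝ) ≤ n := by exact_mod_cast hn1
          have hcorner : (1 : ℝ) ≤ (n : ℝ) / L ^ 3 * η ^ 3 := by
            -- `u = 8πρa`, `ξ = u^{-1/2}`, `ρ ξ³ ≥ 2` because `4u³ ≤ ρ²`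
            set u : ℝ := 8 * Real.pi * ρ * a with hu_def
            have hu : 0 < u := by positivity
            have hξη : u ^ (-(1 / 2 : ℝ)) ≤ η := le_max_left _ _
            have hξ3 : (u ^ (-(1 / 2 : ℝ))) ^ 3 = (u ^ (3 / 2 : ℝ))⁻¹ := by
              rw [← Real.rpow_natCast, ← Real.rpow_mul hu.le, ← Real.rpow_neg hu.le]
              norm_num
            have hu32 : 0 < u ^ (3 / 2 : ℝ) := Real.rpow_pos_of_pos hu _
            have hsq : (2 * u ^ (3 / 2 : ℝ)) ^ 2 ≤ ρ ^ 2 := by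
              have h32 : (u ^ (3 / 2 : ℝ)) ^ 2 = u ^ 3 := by
                rw [← Real.rpow_natCast, ← Real.rpow_mul hu.le]
                norm_num
              have hρu : 4 * (8 * Real.pi * a) ^ 3 * ρ ≤ 1 := by
                have hpos : (0 : ℝ) < 4 * (8 * Real.pi * a) ^ 3 + 1 := by positivity
                have h1 : ρ * (4 * (8 * Real.pi * a) ^ 3 + 1) < 1 := by
                  calc ρ * (4 * (8 * Real.pi * a) ^ 3 + 1)
                      < (4 * (8 * Real.pi * a) ^ 3 + 1)⁻¹ * (4 * (8 * Real.pi * a) ^ 3 + 1) :=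
                        mul_lt_mul_of_pos_right hρ₂' hpos
                    _ = 1 := inv_mul_cancel₀ hpos.ne'
                nlinarith
              calc (2 * u ^ (3 / 2 : ℝ)) ^ 2 = 4 * (8 * Real.pi * a) ^ 3 * ρ * ρ ^ 2 := by
                    rw [mul_pow, h32, hu_def]; ring
                _ ≤ 1 * ρ ^ 2 := mul_le_mul_of_nonneg_right hρu (by positivity)
                _ = ρ ^ 2 := one_mul _
            have h2u : 2 * u ^ (3 / 2 : ℝ) ≤ ρ :=
              (pow_le_pow_iff_left₀ (by positivity) hρ.le two_ne_zero).1 hsq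
            have hρξ : (2 : ℝ) ≤ ρ * (u ^ (-(1 / 2 : ℝ))) ^ 3 := by
              rw [hξ3, ← div_eq_mul_inv, le_div_iff₀ hu32]
              linarith
            have hη3 : ρ * (u ^ (-(1 / 2 : ℝ))) ^ 3 ≤ ρ * η ^ 3 :=
              mul_le_mul_of_nonneg_left (pow_le_pow_left₀ (by positivity) hξη 3) hρ.le
            rw [hL3]
            calc (1 : ℝ) ≤ n / (n + 1) * (ρ * (u ^ (-(1 / 2 : ℝ))) ^ 3) := by
                  have hfr : (1 : ℝ) / 2 ≤ n / (n + 1) := by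
                    rw [div_le_div_iff₀ (by norm_num) (by positivity)]; linarith
                  nlinarith
              _ ≤ n / (n + 1) * (ρ * η ^ 3) := mul_le_mul_of_nonneg_left hη3 (by positivity)
              _ = n / ((n + 1) / ρ) * η ^ 3 := by field_simp
          have hcoup : b * ((n : ℝ) / L ^ 3) ^ (2 / 3 : ℝ) ≤ Γ₀ := by
            have hfrac : (n : ℝ) / L ^ 3 ≤ ρ := by
              rw [hL3, div_le_iff₀ (by positivity)]
              rw [mul_div_assoc']
              rw [le_div_iff₀ hρ]
              nlinarith
            have hfrac0 : 0 ≤ (n : ℝ) / L ^ 3 := by positivity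
            calc b * ((n : ℝ) / L ^ 3) ^ (2 / 3 : ℝ) ≤ b * ρ ^ (2 / 3 : ℝ) :=
                  mul_le_mul_of_nonneg_left (Real.rpow_le_rpow hfrac0 hfrac (by norm_num)) hb0
              _ = K * ρ ^ (1 / 6 : ℝ) := by
                  rw [hb_def, hK_def, Real.div_rpow ha0 hρ.le]
                  have h16 : ρ ^ (1 / 6 : ℝ) = ρ ^ (2 / 3 : ℝ) / ρ ^ (1 / 2 : ℝ) := by
                    rw [← Real.rpow_sub hρ]; norm_num
                  rw [h16]
                  have hρ12 : 0 < ρ ^ (1 / 2 : ℝ) := Real.rpow_pos_of_pos hρ _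
                  field_simp
              _ ≤ Γ₀ := (hsmall ρ hρ hρ₁').le
          have h1 := hC n L b η 2 hL hb hη0 hLn (by norm_num) (by norm_num) hcorner hcoup _ rfl _ rfl y
          exact (ENNReal.div_le_of_le_mul h1).trans (ENNReal.ofReal_le_ofReal (le_max_left C 1))
    _ = ENNReal.ofReal (max A 0 * (1 + max C 1)) := by
        rw [ENNReal.ofReal_mul (le_max_right _ _), ENNReal.ofReal_add zero_le_one (by positivity),
          ENNReal.ofReal_one]

/-- **Converse direction (the candidate is weaker than the crux).** `CoarseGrainedReverseHolder` implies
the field-moment domination form of `BoseRieszMembership` outright (take `A := C` and use `1 ≤ 1 + S`):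
together with `coarseGrainedReverseHolder_of_fieldMomentDomination` this places the typed candidate as a
genuine intermediate — implied by the crux, and implying it given `RieszShadowFieldMoment`. -/
theorem fieldMomentDomination_of_coarseGrainedReverseHolder (hC : CoarseGrainedReverseHolder) :
    ∀ v : ℝ → ENNReal, BoseGas.IsRepulsiveFiniteRange v →
    ∃ ρ₀ : ℝ, 0 < ρ₀ ∧ ∀ ρ : ℝ, 0 < ρ → ρ < ρ₀ → ∀ ℓ : ℝ, 0 < ℓ → ∃ A : ℝ,
    ∀ᶠ n : ℕ in Filter.atTop, ∃ δ : ENNReal, 0 < δ ∧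
      ∀ Ψ : BoseGas.TrialState (n + 1) (BoseGas.sideLength ρ (n + 1)),
        BoseGas.energy v Ψ ≤ BoseGas.groundStateEnergy v (n + 1) (BoseGas.sideLength ρ (n + 1)) + δ →
        (∀ X, Ψ.ψ X = (‖Ψ.ψ X‖ : ℂ)) →
        let L := BoseGas.sideLength ρ (n + 1)
        let m := ⌊L / ℓ⌋₊
        let a := (BoseGas.scatteringLength v).toReal
        let b := 2 * Real.pi ^ (-(3 / 2 : ℝ)) * (a / ρ) ^ (1 / 2 : ℝ)
        let η := max ((8 * Real.pi * ρ * a) ^ (-(1 / 2 : ℝ))) (ρ ^ (-(1 / 3 : ℝ)))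
        let g : BoseGas.Space → ℝ := fun x =>
          2 * Real.pi ^ (3 / 2 : ℝ) * ∫ t in Set.Ioi (η ^ 2), t ^ (-(1 / 2 : ℝ)) *
            ((∑' mm : Fin 3 → ℤ, Literature.Analysis.UnboundedOperators.heatKernel t
              (x - BoseGas.latticeVec L mm)) - 1 / L ^ 3)
        let H : BoseGas.Config n → ℝ := fun X => ∑ i : Fin n, ∑ j : Fin n with i < j, g (X i - X j)
        (m : ENNReal) ^ 3 * ∫⁻ X : Fin n → EuclideanSpace ℝ (Fin 3),
            ((∑ k : Fin 3 → Fin m,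
                (∫⁻ y in {y : EuclideanSpace ℝ (Fin 3) |
                    ∀ i, y i ∈ Set.Ico ((k i : ℝ) * (L / m)) (((k i : ℝ) + 1) * (L / m))},
                  (‖Ψ.ψ (Matrix.vecCons y X)‖₊ : ENNReal) ^ 2) ^ 2) /
              (∫⁻ y, (‖Ψ.ψ (Matrix.vecCons y X)‖₊ : ENNReal) ^ 2))
          ≤ ENNReal.ofReal A * (1 +
            ⨆ y : BoseGas.Space,
              (∫⁻ X in BoseGas.cellN n L,
                  ENNReal.ofReal (Real.exp (-(b * H X) - 2 * b * ∑ j : Fin n, g (y - X j)))) /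
              (∫⁻ X in BoseGas.cellN n L, ENNReal.ofReal (Real.exp (-(b * H X))))) := by
  intro v hv
  obtain ⟨ρ₀, hρ₀, h⟩ := hC v hv
  refine ⟨ρ₀, hρ₀, fun ρ hρ hρlt ℓ hℓ => ?_⟩
  obtain ⟨C, hCev⟩ := h ρ hρ hρlt ℓ hℓ
  refine ⟨C, ?_⟩
  filter_upwards [hCev] with n hn
  obtain ⟨δ, hδ, hΨ⟩ := hn
  refine ⟨δ, hδ, fun Ψ hE hpos => ?_⟩
  have key := hΨ Ψ hE hpos
  dsimp only at key ⊢
  refine key.trans ?_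
  calc ENNReal.ofReal C = ENNReal.ofReal C * 1 := (mul_one _).symm
    _ ≤ _ := by gcongr; exact le_self_add

end Summit.AtomisticToContinuum.BoseEinsteinCondensation.Theorems
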